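import Literature.Probability.LatticeModels.CornerFugacityMeasure

/-!
# Stub `stub_BoxResampler` (line `pinned-diagram-exchange`, crux stmt-CriticalPhenomena-5076) —
# part G: the finite Gibbs algebra of the corner-fugacity field (domain Markov property, atom level)

Theorem-only support file (`--supports stmt-CriticalPhenomena-5076`, registered sub-goal
`boxResampler_gibbsMarkov`). Generic facts about the finite-volume corner Gibbs distributions
`cornerGibbsMeasure t V Λ ξ` of `Literature/Probability/LatticeModels/CornerFugacityMeasure.lean`:

* locality / splitting of the Boltzmann weight `cornerWeight` (a face reads the four cells of its block);
* the product-atom formula for `cornerGibbsMeasure ⊗ ν`;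
* MIXING OF COINS: merging two independent i.i.d. coin fields along any set of faces gives an i.i.d. coin
  field (`coin_merge`);
* the DOMAIN MARKOV PROPERTY in kernel form (`boxResampler_gibbsMarkov`): for `B ⊆ Λ` and interaction sets
  `VB ⊆ V` such that the faces of `V ∖ VB` avoid `B`, resampling the colours of `B` from the Gibbs
  distribution in `B` with interaction `VB` and boundary condition the current colouring, and the coins on
  any face set `F` by fresh coins, preserves `cornerGibbsMeasure t V Λ ξ₀ ⊗ coinMeasure b`;
* COMPARABILITY of two boundary conditions (`prod_cornerGibbs_le_of_sections`): the laws in `B` under two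
  boundary conditions differ by at most the factor `t^{-2M}`, `M` the number of faces of `VB` not inside `B`.
-/

noncomputable section

namespace Summit.CriticalPhenomena.CardyFormulaZ2.Theorems.IKLinearTransport.PinnedDiagramExchange
namespace BoxResampler

open scoped Classical BigOperators ENNReal NNReal
open MeasureTheory Finset
open Literature.Probability.LatticeModels Literature.Probability.Percolation

/-! ## Sums over the subsets of a volume, split along a sub-volume -/

/-- Splitting a sum over the subsets of `Λ` along `B ⊆ Λ`: `s ↦ (s ∖ B, s ∩ B)`. [folklore] -/
theorem sum_powerset_split {M : Type*} [AddCommMonoid M] {Λ B : Finset (Site 2)} (hB : B ⊆ Λ)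
    (g : Finset (Site 2) → M) :
    ∑ s ∈ Λ.powerset, g s = ∑ p ∈ (Λ \ B).powerset, ∑ q ∈ B.powerset, g (p ∪ q) := by
  rw [← sum_product']
  refine sum_nbij' (fun s => (s \ B, s ∩ B)) (fun pq => pq.1 ∪ pq.2) ?_ ?_ ?_ ?_ ?_
  · intro s hs
    exact mem_product.2 ⟨mem_powerset.2 (sdiff_subset_sdiff (mem_powerset.1 hs) subset_rfl),
      mem_powerset.2 inter_subset_right⟩
  · intro pq hpq
    obtain ⟨h1, h2⟩ := mem_product.1 hpq
    rw [mem_powerset] at h1 h2 ⊢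
    exact union_subset (h1.trans sdiff_subset) (h2.trans hB)
  · exact fun s _ => sdiff_union_inter s B
  · intro pq hpq
    obtain ⟨h1, h2⟩ := mem_product.1 hpq
    rw [mem_powerset] at h1 h2
    have hd : Disjoint pq.1 B := disjoint_left.2 fun x hx hxB => (mem_sdiff.1 (h1 hx)).2 hxB
    refine Prod.ext ?_ ?_
    · rw [union_sdiff_distrib, sdiff_eq_self_of_disjoint hd, sdiff_eq_empty_iff_subset.2 h2, union_empty]
    · rw [union_inter_distrib_right, disjoint_iff_inter_eq_empty.1 hd, inter_eq_left.2 h2, empty_union]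
  · exact fun s _ => by rw [sdiff_union_inter]

/-! ## Locality and splitting of the Boltzmann weight -/

/-- A face reads the four cells of its block. [folklore] -/
theorem isOddFace_congr {σ σ' : Site 2 → Bool} {f : Site 2} (h : ∀ c ∈ cellFace f, σ c = σ' c) :
    IsOddFace σ f ↔ IsOddFace σ' f := by
  rw [isOddFace_iff_xor, isOddFace_iff_xor, h f (self_mem_cellFace f),
    h _ (mem_cellFace_iff.2 (Or.inr (Or.inl rfl))), h _ (mem_cellFace_iff.2 (Or.inr (Or.inr (Or.inl rfl)))),
    h _ (mem_cellFace_iff.2 (Or.inr (Or.inr (Or.inr rfl))))]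

/-- The weight over `V` reads the cells of the blocks of the faces of `V` only. [folklore] -/
theorem cornerWeight_congr (t : ℝ≥0) {V : Finset (Site 2)} {σ σ' : Site 2 → Bool}
    (h : ∀ f ∈ V, ∀ c ∈ cellFace f, σ c = σ' c) : cornerWeight t V σ = cornerWeight t V σ' := by
  unfold cornerWeight oddFaceCount
  rw [filter_congr fun f hf => isOddFace_congr (h f hf)]

/-- The weight is multiplicative over disjoint interaction sets. [folklore] -/
theorem cornerWeight_union (t : ℝ≥0) {V₁ V₂ : Finset (Site 2)} (h : Disjoint V₁ V₂) (σ : Site 2 → Bool) :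
    cornerWeight t (V₁ ∪ V₂) σ = cornerWeight t V₁ σ * cornerWeight t V₂ σ := by
  unfold cornerWeight oddFaceCount
  rw [filter_union, card_union_of_disjoint (disjoint_filter_filter h), pow_add]

/-- The weight over `V` is at most `1` when `t ≤ 1`. [folklore] -/
theorem cornerWeight_le_one {t : ℝ≥0} (ht : t ≤ 1) (V : Finset (Site 2)) (σ : Site 2 → Bool) :
    cornerWeight t V σ ≤ 1 :=
  pow_le_one₀ bot_le (by exact_mod_cast ht)

/-- The weight over `V` is at least `t ^ |V|` when `t ≤ 1`. [folklore] -/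
theorem pow_card_le_cornerWeight {t : ℝ≥0} (ht : t ≤ 1) (V : Finset (Site 2)) (σ : Site 2 → Bool) :
    (t : ℝ≥0∞) ^ V.card ≤ cornerWeight t V σ :=
  pow_le_pow_right_of_le_one' (by exact_mod_cast ht) (card_filter_le _ _)

/-- Fillings of `B` with two boundary conditions agreeing off `B` coincide. [folklore] -/
theorem boxFill_congr_off {B : Finset (Site 2)} {σ σ' : Site 2 → Bool} (h : ∀ c ∉ B, σ c = σ' c)
    (s : Finset (Site 2)) : boxFill B σ s = boxFill B σ' s := by
  funext c
  by_cases hc : c ∈ B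
  · rw [boxFill_apply_of_mem _ _ hc, boxFill_apply_of_mem _ _ hc]
  · rw [boxFill_apply_of_not_mem _ _ hc, boxFill_apply_of_not_mem _ _ hc, h c hc]

/-- The partition function of `B` reads the boundary condition off `B` only. [folklore] -/
theorem cornerPartitionFunction_congr_off (t : ℝ≥0) (V B : Finset (Site 2)) {σ σ' : Site 2 → Bool}
    (h : ∀ c ∉ B, σ c = σ' c) : cornerPartitionFunction t V B σ = cornerPartitionFunction t V B σ' :=
  sum_congr rfl fun s _ => by rw [boxFill_congr_off h]

/-- Re-filling a sub-volume: for `q ⊆ B ⊆ Λ`, filling `B` inside the filling of `Λ` by `p` with the black set `q`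
is the filling of `Λ` by `p ∖ B ∪ q`. [folklore] -/
theorem boxFill_boxFill {Λ B : Finset (Site 2)} (hB : B ⊆ Λ) (ξ : Site 2 → Bool) (p : Finset (Site 2))
    {q : Finset (Site 2)} (hq : q ⊆ B) : boxFill B (boxFill Λ ξ p) q = boxFill Λ ξ (p \ B ∪ q) := by
  funext c
  by_cases hcB : c ∈ B
  · rw [boxFill_apply_of_mem _ _ hcB, boxFill_apply_of_mem _ _ (hB hcB)]
    simp only [mem_union, mem_sdiff, hcB, not_true_eq_false, and_false, false_or]
  · rw [boxFill_apply_of_not_mem _ _ hcB]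
    by_cases hcΛ : c ∈ Λ
    · rw [boxFill_apply_of_mem _ _ hcΛ, boxFill_apply_of_mem _ _ hcΛ]
      have : c ∉ q := fun h => hcB (hq h)
      simp only [mem_union, mem_sdiff, hcB, not_false_eq_true, and_true, this, or_false]
    · rw [boxFill_apply_of_not_mem _ _ hcΛ, boxFill_apply_of_not_mem _ _ hcΛ]

/-! ## The product-atom formula -/

/-- Integrating against a corner Gibbs distribution: a normalised finite sum over the fillings. [folklore] -/
theorem lintegral_cornerGibbs (t : ℝ≥0) (V Λ : Finset (Site 2)) (ξ : Site 2 → Bool) (g : (Site 2 → Bool) → ℝ≥0∞) :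
    ∫⁻ σ, g σ ∂(cornerGibbsMeasure t V Λ ξ) =
      (cornerPartitionFunction t V Λ ξ)⁻¹ * ∑ s ∈ Λ.powerset, cornerWeight t V (boxFill Λ ξ s) * g (boxFill Λ ξ s) := by
  rw [cornerGibbsMeasure, lintegral_smul_measure, lintegral_finsetSum_measure, smul_eq_mul]
  congr 1
  refine sum_congr rfl fun s _ => ?_
  rw [lintegral_smul_measure, lintegral_dirac, smul_eq_mul]

/-- PRODUCT-ATOM FORMULA: the mass of a measurable set under `cornerGibbsMeasure ⊗ ν` is the normalised
weighted sum of the `ν`-masses of its sections at the fillings. [folklore] -/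
theorem prod_cornerGibbs_apply {Y : Type*} [MeasurableSpace Y] (t : ℝ≥0) (V Λ : Finset (Site 2))
    (ξ : Site 2 → Bool) (ν : Measure Y) [SFinite ν] {T : Set ((Site 2 → Bool) × Y)} (hT : MeasurableSet T) :
    ((cornerGibbsMeasure t V Λ ξ).prod ν) T = (cornerPartitionFunction t V Λ ξ)⁻¹ *
      ∑ s ∈ Λ.powerset, cornerWeight t V (boxFill Λ ξ s) * ν (Prod.mk (boxFill Λ ξ s) ⁻¹' T) := by
  rw [Measure.prod_apply hT, lintegral_cornerGibbs]

/-- COMPARABILITY OF BOUNDARY CONDITIONS (`0 < t ≤ 1`, `Vin ⊆ VB` faces whose blocks lie inside `B`): if the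
`ν`-sections of `T` at the fillings of `B` do not depend on the boundary condition, the masses of `T` under the
two product laws differ by at most the factor `(t⁻¹) ^ (2 |VB ∖ Vin|)`. [folklore] -/
theorem prod_cornerGibbs_le_of_sections {Y : Type*} [MeasurableSpace Y] {t : ℝ≥0} (ht0 : t ≠ 0) (ht1 : t ≤ 1)
    {VB Vin B : Finset (Site 2)} (hVin : Vin ⊆ VB) (hin : ∀ f ∈ Vin, cellFace f ⊆ B) (ξ ξ' : Site 2 → Bool)
    (ν : Measure Y) [SFinite ν] {T : Set ((Site 2 → Bool) × Y)} (hT : MeasurableSet T)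
    (hsec : ∀ s ⊆ B, ν (Prod.mk (boxFill B ξ s) ⁻¹' T) = ν (Prod.mk (boxFill B ξ' s) ⁻¹' T)) :
    ((cornerGibbsMeasure t VB B ξ).prod ν) T ≤
      ((t : ℝ≥0∞)⁻¹) ^ (2 * (VB \ Vin).card) * ((cornerGibbsMeasure t VB B ξ').prod ν) T := by
  set R : ℝ≥0∞ := ((t : ℝ≥0∞)⁻¹) ^ (VB \ Vin).card with hR
  have htc : (t : ℝ≥0∞) ≠ 0 := by exact_mod_cast ht0
  have hRt : R * (t : ℝ≥0∞) ^ (VB \ Vin).card = 1 := by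
    rw [hR, ← mul_pow, ENNReal.inv_mul_cancel htc ENNReal.coe_ne_top, one_pow]
  -- termwise comparison of the weights of the fillings under the two boundary conditions
  have hW : ∀ (η η' : Site 2 → Bool) (s : Finset (Site 2)), s ⊆ B →
      cornerWeight t VB (boxFill B η s) ≤ R * cornerWeight t VB (boxFill B η' s) := by
    intro η η' s _
    have hdisj : Disjoint Vin (VB \ Vin) := disjoint_sdiff
    have hsplit : ∀ η : Site 2 → Bool, cornerWeight t VB (boxFill B η s) =
        cornerWeight t Vin (boxFill B η s) * cornerWeight t (VB \ Vin) (boxFill B η s) := fun η => by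
      rw [← cornerWeight_union t hdisj, union_sdiff_of_subset hVin]
    rw [hsplit η, hsplit η']
    have hVineq : cornerWeight t Vin (boxFill B η s) = cornerWeight t Vin (boxFill B η' s) :=
      cornerWeight_congr t fun f hf c hc => by
        rw [boxFill_apply_of_mem _ _ (hin f hf hc), boxFill_apply_of_mem _ _ (hin f hf hc)]
    rw [hVineq, mul_left_comm]
    gcongr
    calc cornerWeight t (VB \ Vin) (boxFill B η s) ≤ 1 := cornerWeight_le_one ht1 _ _
      _ = R * (t : ℝ≥0∞) ^ (VB \ Vin).card := hRt.symm
      _ ≤ R * cornerWeight t (VB \ Vin) (boxFill B η' s) := by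
        gcongr
        exact pow_card_le_cornerWeight ht1 _ _
  have hZ : cornerPartitionFunction t VB B ξ' ≤ R * cornerPartitionFunction t VB B ξ := by
    rw [cornerPartitionFunction, cornerPartitionFunction, mul_sum]
    exact sum_le_sum fun s hs => hW ξ' ξ s (mem_powerset.1 hs)
  have hZne : cornerPartitionFunction t VB B ξ' ≠ 0 := cornerPartitionFunction_ne_zero ht0 _ _ _
  have hZtop : cornerPartitionFunction t VB B ξ' ≠ ⊤ := cornerPartitionFunction_ne_top _ _ _ _
  have hZinv : (cornerPartitionFunction t VB B ξ)⁻¹ ≤ R * (cornerPartitionFunction t VB B ξ')⁻¹ := by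
    calc (cornerPartitionFunction t VB B ξ)⁻¹
        = (cornerPartitionFunction t VB B ξ)⁻¹ * (cornerPartitionFunction t VB B ξ' *
            (cornerPartitionFunction t VB B ξ')⁻¹) := by
          rw [ENNReal.mul_inv_cancel hZne hZtop, mul_one]
      _ ≤ (cornerPartitionFunction t VB B ξ)⁻¹ * (R * cornerPartitionFunction t VB B ξ *
            (cornerPartitionFunction t VB B ξ')⁻¹) := by gcongr
      _ = R * ((cornerPartitionFunction t VB B ξ)⁻¹ * cornerPartitionFunction t VB B ξ) *
            (cornerPartitionFunction t VB B ξ')⁻¹ := by ring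
      _ = R * (cornerPartitionFunction t VB B ξ')⁻¹ := by
          rw [ENNReal.inv_mul_cancel (cornerPartitionFunction_ne_zero ht0 _ _ _)
            (cornerPartitionFunction_ne_top _ _ _ _), mul_one]
  rw [prod_cornerGibbs_apply t VB B ξ ν hT, prod_cornerGibbs_apply t VB B ξ' ν hT, two_mul, pow_add]
  calc (cornerPartitionFunction t VB B ξ)⁻¹ *
        ∑ s ∈ B.powerset, cornerWeight t VB (boxFill B ξ s) * ν (Prod.mk (boxFill B ξ s) ⁻¹' T)
      ≤ (R * (cornerPartitionFunction t VB B ξ')⁻¹) *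
        ∑ s ∈ B.powerset, R * cornerWeight t VB (boxFill B ξ' s) * ν (Prod.mk (boxFill B ξ' s) ⁻¹' T) := by
        refine mul_le_mul' hZinv (sum_le_sum fun s hs => ?_)
        rw [hsec s (mem_powerset.1 hs)]
        gcongr
        exact hW ξ ξ' s (mem_powerset.1 hs)
    _ = R * R * ((cornerPartitionFunction t VB B ξ')⁻¹ *
        ∑ s ∈ B.powerset, cornerWeight t VB (boxFill B ξ' s) * ν (Prod.mk (boxFill B ξ' s) ⁻¹' T)) := by
        simp only [mul_assoc]
        rw [← mul_sum]
        ring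

/-! ## Mixing of coins -/

/-- Merging two coin fields along `F`: the coins of `F` from the second field, the others from the first. [folklore] -/
theorem measurable_coinMerge (F : Set (Site 2)) :
    Measurable fun p : (Site 2 → Bool) × (Site 2 → Bool) => fun v => if v ∈ F then p.2 v else p.1 v := by
  refine measurable_pi_lambda _ fun v => ?_
  by_cases hv : v ∈ F
  · simp only [hv, if_true]; exact (measurable_pi_apply v).comp measurable_snd
  · simp only [hv, if_false]; exact (measurable_pi_apply v).comp measurable_fst

/-- MIXING OF COINS: merging two independent i.i.d. coin fields along any set of faces `F` gives an i.i.d.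
coin field (the merged field has independent coordinates with the same marginals). [folklore] -/
theorem coin_merge (b : unitInterval) (F : Set (Site 2)) :
    ((coinMeasure b).prod (coinMeasure b)).map
      (fun p : (Site 2 → Bool) × (Site 2 → Bool) => fun v => if v ∈ F then p.2 v else p.1 v) = coinMeasure b := by
  unfold coinMeasure
  refine Measure.eq_infinitePi _ fun s t ht => ?_
  rw [Measure.map_apply (measurable_coinMerge F) (MeasurableSet.pi s.countable_toSet fun i _ => ht i)]
  have hpre : (fun p : (Site 2 → Bool) × (Site 2 → Bool) => fun v => if v ∈ F then p.2 v else p.1 v) ⁻¹'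
      Set.pi (↑s) t = (Set.pi (↑(s.filter fun v => v ∉ F)) t) ×ˢ (Set.pi (↑(s.filter fun v => v ∈ F)) t) := by
    ext p
    simp only [Set.mem_preimage, Set.mem_pi, mem_coe, Set.mem_prod, mem_filter]
    constructor
    · intro h
      exact ⟨fun i hi => by simpa only [hi.2, if_false] using h i hi.1,
        fun i hi => by simpa only [hi.2, if_true] using h i hi.1⟩
    · rintro ⟨h1, h2⟩ i hi
      by_cases hiF : i ∈ F
      · simpa only [hiF, if_true] using h2 i ⟨hi, hiF⟩
      · simpa only [hiF, if_false] using h1 i ⟨hi, hiF⟩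
  rw [hpre, Measure.prod_prod, Measure.infinitePi_pi _ (fun i _ => ht i), Measure.infinitePi_pi _ (fun i _ => ht i),
    mul_comm, prod_filter_mul_prod_filter_not]

/-! ## The domain Markov property in kernel form -/

/-- A face of `V` off `VB` avoids `B`; then fillings of `Λ` that agree off `B` have the same `V ∖ VB` weight. [folklore] -/
theorem cornerWeight_sdiff_congr (t : ℝ≥0) {Λ B V VB : Finset (Site 2)} (havoid : ∀ f ∈ V, f ∉ VB → ∀ c ∈ cellFace f, c ∉ B)
    (ξ : Site 2 → Bool) {p p' : Finset (Site 2)} (h : ∀ c ∉ B, (c ∈ p ↔ c ∈ p')) :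
    cornerWeight t (V \ VB) (boxFill Λ ξ p) = cornerWeight t (V \ VB) (boxFill Λ ξ p') :=
  cornerWeight_congr t fun f hf c hc => by
    have hcB : c ∉ B := havoid f (mem_sdiff.1 hf).1 (mem_sdiff.1 hf).2 c hc
    by_cases hcΛ : c ∈ Λ
    · rw [boxFill_apply_of_mem _ _ hcΛ, boxFill_apply_of_mem _ _ hcΛ]
      simp only [h c hcB]
    · rw [boxFill_apply_of_not_mem _ _ hcΛ, boxFill_apply_of_not_mem _ _ hcΛ]

/-- THE DOMAIN MARKOV PROPERTY OF THE CORNER-FUGACITY FIELD, kernel form (registered sub-goal). Let `B ⊆ Λ`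
be finite volumes, `VB ⊆ V` interaction sets such that every face of `V ∖ VB` avoids `B`, `F` any set of faces,
`t ≠ 0`. The kernel that resamples the colours of `B` from the Gibbs distribution in `B` with interaction `VB`
and boundary condition the current colouring, and the coins of `F` by fresh `Bernoulli(b)` coins, preserves
`cornerGibbsMeasure t V Λ ξ₀ ⊗ coinMeasure b`: for every measurable `T` (with the kernel evaluation measurable),
`∫ K(z)(T) dμ(z) = μ(T)`. Proof: both sides are normalised finite sums over fillings (product-atom formula);
the weight of a filling splits as (weight of the faces avoiding `B`, a function of the colours off `B`) ×
(weight of `VB`), the inner normalisation cancels the `VB`-part summed over the old colours of `B`, and merged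
coins are fresh coins (`coin_merge`). [folklore] -/
theorem boxResampler_gibbsMarkov :
    ∀ (t : ℝ≥0), t ≠ 0 → ∀ (b : unitInterval) (Λ B V VB : Finset (Site 2)) (F : Set (Site 2)) (ξ₀ : Site 2 → Bool),
      B ⊆ Λ → VB ⊆ V → (∀ f ∈ V, f ∉ VB → ∀ c ∈ cellFace f, c ∉ B) →
      ∀ (T : Set ((Site 2 → Bool) × (Site 2 → Bool))), MeasurableSet T →
      (Measurable fun z : (Site 2 → Bool) × (Site 2 → Bool) =>
        ((cornerGibbsMeasure t VB B z.1).prod (coinMeasure b))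
          {z' | ((fun v => if v ∈ B then z'.1 v else z.1 v), (fun v => if v ∈ F then z'.2 v else z.2 v)) ∈ T}) →
      ∫⁻ z, ((cornerGibbsMeasure t VB B z.1).prod (coinMeasure b))
          {z' | ((fun v => if v ∈ B then z'.1 v else z.1 v), (fun v => if v ∈ F then z'.2 v else z.2 v)) ∈ T}
        ∂((cornerGibbsMeasure t V Λ ξ₀).prod (coinMeasure b)) =
      ((cornerGibbsMeasure t V Λ ξ₀).prod (coinMeasure b)) T := by
  intro t ht b Λ B V VB F ξ₀ hB hVB havoid T hT hmeas
  -- notation: fillings of `Λ`, the merge map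
  set φ : Finset (Site 2) → Site 2 → Bool := boxFill Λ ξ₀ with hφ
  set mrg : (Site 2 → Bool) × (Site 2 → Bool) → (Site 2 → Bool) × (Site 2 → Bool) →
      (Site 2 → Bool) × (Site 2 → Bool) :=
    fun z z' => ((fun v => if v ∈ B then z'.1 v else z.1 v), (fun v => if v ∈ F then z'.2 v else z.2 v)) with hmrg
  have hmrg_meas : ∀ z, Measurable (mrg z) := fun z => by
    refine Measurable.prodMk (measurable_pi_lambda _ fun v => ?_) (measurable_pi_lambda _ fun v => ?_)
    · by_cases hv : v ∈ B
      · simp only [hv, if_true]; exact (measurable_pi_apply v).comp measurable_fst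
      · simp only [hv, if_false]; exact measurable_const
    · by_cases hv : v ∈ F
      · simp only [hv, if_true]; exact (measurable_pi_apply v).comp measurable_snd
      · simp only [hv, if_false]; exact measurable_const
  -- merging a filling of `B` into its own boundary condition is the filling
  have hmrg_fill : ∀ (σ : Site 2 → Bool) (s : Finset (Site 2)) (κ κ' : Site 2 → Bool),
      mrg (σ, κ) (boxFill B σ s, κ') = (boxFill B σ s, fun v => if v ∈ F then κ' v else κ v) := by
    intro σ s κ κ'
    simp only [hmrg, Prod.mk.injEq, and_true]
    funext v
    by_cases hv : v ∈ B
    · rw [if_pos hv]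
    · rw [if_neg hv, boxFill_apply_of_not_mem _ _ hv]
  -- the kernel evaluated at `(σ, κ)`: product-atom formula in `B`
  have hK : ∀ (σ κ : Site 2 → Bool), ((cornerGibbsMeasure t VB B σ).prod (coinMeasure b)) {z' | mrg (σ, κ) z' ∈ T} =
      (cornerPartitionFunction t VB B σ)⁻¹ * ∑ s ∈ B.powerset, cornerWeight t VB (boxFill B σ s) *
        coinMeasure b {κ' | (boxFill B σ s, fun v => if v ∈ F then κ' v else κ v) ∈ T} := by
    intro σ κ
    rw [show {z' | mrg (σ, κ) z' ∈ T} = mrg (σ, κ) ⁻¹' T from rfl,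
      prod_cornerGibbs_apply t VB B σ (coinMeasure b) ((hmrg_meas (σ, κ)) hT)]
    congr 1
    refine sum_congr rfl fun s _ => ?_
    congr 1
    congr 1
    ext κ'
    simp only [Set.mem_preimage, Set.mem_setOf_eq, hmrg_fill]
  -- coin mixing: integrating the section of the merged coins gives the section of fresh coins
  have hMc : ∀ c : Site 2 → Bool, MeasurableSet
      {p : (Site 2 → Bool) × (Site 2 → Bool) | (c, fun v => if v ∈ F then p.2 v else p.1 v) ∈ T} :=
    fun c => (measurable_const.prodMk (measurable_coinMerge F)) hT
  have hsec_meas : ∀ c : Site 2 → Bool, Measurable fun κ : Site 2 → Bool =>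
      coinMeasure b {κ' | (c, fun v => if v ∈ F then κ' v else κ v) ∈ T} :=
    fun c => measurable_measure_prodMk_left (hMc c)
  have hmix : ∀ c : Site 2 → Bool,
      ∫⁻ κ, coinMeasure b {κ' | (c, fun v => if v ∈ F then κ' v else κ v) ∈ T} ∂(coinMeasure b) =
        coinMeasure b {κ | (c, κ) ∈ T} := by
    intro c
    have hA' : MeasurableSet {κ : Site 2 → Bool | (c, κ) ∈ T} := measurable_prodMk_left hT
    calc ∫⁻ κ, coinMeasure b {κ' | (c, fun v => if v ∈ F then κ' v else κ v) ∈ T} ∂(coinMeasure b)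
        = ∫⁻ κ, coinMeasure b (Prod.mk κ ⁻¹'
            {p : (Site 2 → Bool) × (Site 2 → Bool) | (c, fun v => if v ∈ F then p.2 v else p.1 v) ∈ T})
            ∂(coinMeasure b) := rfl
      _ = ((coinMeasure b).prod (coinMeasure b))
            {p : (Site 2 → Bool) × (Site 2 → Bool) | (c, fun v => if v ∈ F then p.2 v else p.1 v) ∈ T} :=
          (Measure.prod_apply (hMc c)).symm
      _ = (((coinMeasure b).prod (coinMeasure b)).map
            (fun p : (Site 2 → Bool) × (Site 2 → Bool) => fun v => if v ∈ F then p.2 v else p.1 v))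
            {κ | (c, κ) ∈ T} := by
          rw [Measure.map_apply (measurable_coinMerge F) hA']; rfl
      _ = coinMeasure b {κ | (c, κ) ∈ T} := by rw [coin_merge]
  -- the inner (coin) integral of the kernel at the filling `σ`
  have hinner : ∀ σ : Site 2 → Bool,
      ∫⁻ κ, ((cornerGibbsMeasure t VB B σ).prod (coinMeasure b)) {z' | mrg (σ, κ) z' ∈ T} ∂(coinMeasure b) =
        (cornerPartitionFunction t VB B σ)⁻¹ * ∑ s ∈ B.powerset, cornerWeight t VB (boxFill B σ s) *
          coinMeasure b {κ | (boxFill B σ s, κ) ∈ T} := by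
    intro σ
    simp_rw [hK]
    rw [lintegral_const_mul _ (Finset.measurable_sum _ fun s _ => (hsec_meas _).const_mul _),
      lintegral_finsetSum _ fun s _ => (hsec_meas _).const_mul _]
    congr 1
    refine sum_congr rfl fun s _ => ?_
    rw [lintegral_const_mul _ (hsec_meas _), hmix]
  -- both sides as normalised sums over the fillings of `Λ`
  have hKmeas : Measurable fun z : (Site 2 → Bool) × (Site 2 → Bool) =>
      ((cornerGibbsMeasure t VB B z.1).prod (coinMeasure b)) {z' | mrg z z' ∈ T} := hmeas
  rw [lintegral_prod _ hKmeas.aemeasurable, lintegral_cornerGibbs,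
    prod_cornerGibbs_apply t V Λ ξ₀ (coinMeasure b) hT]
  congr 1
  simp_rw [hinner]
  rw [sum_powerset_split hB, sum_powerset_split hB]
  refine sum_congr rfl fun p hp => ?_
  -- `p ⊆ Λ ∖ B`: the old colours off `B`
  have hpB : ∀ c ∈ p, c ∉ B := fun c hc => (mem_sdiff.1 (mem_powerset.1 hp hc)).2
  have hpsd : p \ B = p := sdiff_eq_self_of_disjoint (disjoint_left.2 hpB)
  have hfill : ∀ q ⊆ B, φ (p ∪ q) = boxFill B (φ p) q := fun q hq => by
    rw [hφ, boxFill_boxFill hB ξ₀ p hq, hpsd]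
  have hoff : ∀ q ⊆ B, ∀ c ∉ B, φ (p ∪ q) c = φ p c := fun q hq c hc => by
    rw [hfill q hq, boxFill_apply_of_not_mem _ _ hc]
  have hWsplit : ∀ q ⊆ B, cornerWeight t V (φ (p ∪ q)) =
      cornerWeight t (V \ VB) (φ p) * cornerWeight t VB (boxFill B (φ p) q) := fun q hq => by
    rw [← union_sdiff_of_subset hVB, cornerWeight_union t disjoint_sdiff, union_sdiff_of_subset hVB, mul_comm,
      ← hfill q hq]
    congr 1
    exact cornerWeight_sdiff_congr t havoid ξ₀ fun c hc => by
      simp only [mem_union, or_iff_left_iff_imp]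
      exact fun h => absurd h (fun h' => hc (hq h'))
  have hZp0 : cornerPartitionFunction t VB B (φ p) ≠ 0 := cornerPartitionFunction_ne_zero ht _ _ _
  have hZptop : cornerPartitionFunction t VB B (φ p) ≠ ⊤ := cornerPartitionFunction_ne_top _ _ _ _
  calc ∑ q ∈ B.powerset, cornerWeight t V (φ (p ∪ q)) *
        ((cornerPartitionFunction t VB B (φ (p ∪ q)))⁻¹ * ∑ s ∈ B.powerset,
          cornerWeight t VB (boxFill B (φ (p ∪ q)) s) * coinMeasure b {κ | (boxFill B (φ (p ∪ q)) s, κ) ∈ T})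
      = ∑ q ∈ B.powerset, (cornerWeight t (V \ VB) (φ p) * cornerWeight t VB (boxFill B (φ p) q)) *
        ((cornerPartitionFunction t VB B (φ p))⁻¹ * ∑ s ∈ B.powerset,
          cornerWeight t VB (boxFill B (φ p) s) * coinMeasure b {κ | (boxFill B (φ p) s, κ) ∈ T}) := by
        refine sum_congr rfl fun q hq => ?_
        have hq' : q ⊆ B := mem_powerset.1 hq
        rw [hWsplit q hq', cornerPartitionFunction_congr_off t VB B (hoff q hq')]
        simp only [boxFill_congr_off (hoff q hq')]
    _ = ∑ q ∈ B.powerset, cornerWeight t (V \ VB) (φ p) * ((cornerPartitionFunction t VB B (φ p))⁻¹ *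
          ∑ s ∈ B.powerset, cornerWeight t VB (boxFill B (φ p) s) * coinMeasure b {κ | (boxFill B (φ p) s, κ) ∈ T}) *
        cornerWeight t VB (boxFill B (φ p) q) := sum_congr rfl fun q _ => by ring
    _ = cornerWeight t (V \ VB) (φ p) * ((cornerPartitionFunction t VB B (φ p))⁻¹ * ∑ s ∈ B.powerset,
          cornerWeight t VB (boxFill B (φ p) s) * coinMeasure b {κ | (boxFill B (φ p) s, κ) ∈ T}) *
        ∑ q ∈ B.powerset, cornerWeight t VB (boxFill B (φ p) q) :=
        (mul_sum B.powerset (fun q => cornerWeight t VB (boxFill B (φ p) q)) _).symm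
    _ = cornerWeight t (V \ VB) (φ p) * ∑ s ∈ B.powerset,
          cornerWeight t VB (boxFill B (φ p) s) * coinMeasure b {κ | (boxFill B (φ p) s, κ) ∈ T} := by
        rw [show ∑ q ∈ B.powerset, cornerWeight t VB (boxFill B (φ p) q) = cornerPartitionFunction t VB B (φ p)
          from rfl]
        calc _ = cornerWeight t (V \ VB) (φ p) * (∑ s ∈ B.powerset,
              cornerWeight t VB (boxFill B (φ p) s) * coinMeasure b {κ | (boxFill B (φ p) s, κ) ∈ T}) *
              ((cornerPartitionFunction t VB B (φ p))⁻¹ * cornerPartitionFunction t VB B (φ p)) := by ring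
          _ = _ := by rw [ENNReal.inv_mul_cancel hZp0 hZptop, mul_one]
    _ = ∑ s ∈ B.powerset, cornerWeight t V (φ (p ∪ s)) * coinMeasure b (Prod.mk (φ (p ∪ s)) ⁻¹' T) := by
        rw [mul_sum]
        refine sum_congr rfl fun s hs => ?_
        have hs' : s ⊆ B := mem_powerset.1 hs
        rw [hWsplit s hs', mul_assoc, hfill s hs']
        rfl

end BoxResampler

end Summit.CriticalPhenomena.CardyFormulaZ2.Theorems.IKLinearTransport.PinnedDiagramExchange

end
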